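import Mathlib.MeasureTheory.Measure.Regular
import Mathlib.MeasureTheory.Integral.Lebesgue.Basic
import Mathlib.Topology.Semicontinuity.Basic
import HarnessLib

/-!
# Monotone convergence for directed families of lower semicontinuous functions (τ-smoothness)

Topic `MeasureTheory/Radon`; namespace `Literature.MeasureTheory.Radon`. For a **regular** (outer
Radon) measure `μ` on a topological space, the Lebesgue integral of a lower semicontinuous
function `φ : X → [0, ∞]` that is dominated pointwise by the supremum of an **upward directed,
possibly uncountable** family `(g i)` of lower semicontinuous functions satisfies
`∫⁻ φ dμ ≤ ⨆ i, ∫⁻ g i dμ` (`lintegral_le_iSup_lintegral_of_directed_of_lowerSemicontinuous`).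
With `g i ≤ φ` this is the equality `∫⁻ (⨆ i, g i) dμ = ⨆ i, ∫⁻ g i dμ` — the "τ-smoothness" of
Radon measures (Bourbaki, *Intégration*, Ch. IV §1 no. 1 Thm. 1; Deitmar–Echterhoff, *Principles of
Harmonic Analysis*, Lemma B.3.2, used there in the proof of the quotient integral formula
Thm. 1.5.3 and of Prop. 1.5.6). Mathlib has the countable version (`lintegral_iSup_directed`) only.

Proof: `∫⁻ φ` is the supremum of `∫ s` over `ℝ≥0`-valued simple `s ≤ φ`; for `δ < 1` each level
set `{s = c}`, `c ≠ 0`, lies in the open set `{δ c < φ}`; on a compact subset a Dini / finite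
subcover argument produces one index `i` with `δ c < g i`; inner regularity of `μ` (on open sets,
and on finite-measure sets) and directedness (to merge the finitely many levels) conclude.

Used by `Literature/NumberTheory/Automorphic/HaarIntegralClosedCompactRadonSets.lean` (Haar
integral of `G = HK`, general locally compact groups).
-/

noncomputable section

open MeasureTheory Measure Set
open scoped ENNReal NNReal

namespace Literature.MeasureTheory.Radon

variable {X : Type*} [TopologicalSpace X] [MeasurableSpace X]

/-- **Monotone convergence for directed families of lower semicontinuous functions against a Radon
measure (τ-smoothness), inequality form.** If `μ` is a regular measure, `(g i)` an upward directed
family of lower semicontinuous `ℝ≥0∞`-valued functions and `φ` a lower semicontinuous function with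
`φ ≤ ⨆ i, g i` pointwise, then `∫⁻ φ dμ ≤ ⨆ i, ∫⁻ g i dμ` — although the index set may be
uncountable. (Dini's argument on compact sets plus inner regularity; this is the measure-theoretic
content of Deitmar–Echterhoff Lemma B.3.2 / Bourbaki, *Intégration* IV §1 Thm. 1.) [folklore] -/
theorem lintegral_le_iSup_lintegral_of_directed_of_lowerSemicontinuous [OpensMeasurableSpace X]
    {μ : Measure X} [μ.Regular] {ι : Type*} [Nonempty ι] {g : ι → X → ℝ≥0∞} (hg : ∀ i, LowerSemicontinuous (g i))
    (hdir : Directed (· ≤ ·) g) {φ : X → ℝ≥0∞} (hφ : LowerSemicontinuous φ)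
    (hle : ∀ x, φ x ≤ ⨆ i, g i x) :
    ∫⁻ x, φ x ∂μ ≤ ⨆ i, ∫⁻ x, g i x ∂μ := by
  classical
  -- Dini-type step: on a compact set where `t < φ`, a single `g i` exceeds `t`.
  have dini : ∀ L : Set X, IsCompact L → ∀ t : ℝ≥0∞, (∀ x ∈ L, t < φ x) →
      ∃ i, ∀ x ∈ L, t < g i x := by
    intro L hL t ht
    have hex : ∀ x ∈ L, ∃ i, t < g i x := fun x hx =>
      lt_iSup_iff.mp ((ht x hx).trans_le (hle x))
    choose! ix hix using hex
    obtain ⟨T, hTL⟩ := hL.elim_finite_subcover (fun x : X => {y | t < g (ix x) y})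
      (fun x => (hg (ix x)).isOpen_preimage t) (fun x hx => mem_iUnion.mpr ⟨x, hix x hx⟩)
    obtain ⟨j, hj⟩ := hdir.finset_le (T.image ix)
    refine ⟨j, fun y hy => ?_⟩
    obtain ⟨x, hxT, hxy⟩ := mem_iUnion₂.mp (hTL hy)
    exact lt_of_lt_of_le hxy (hj (ix x) (Finset.mem_image_of_mem ix hxT) y)
  -- one level: `δ c μ(L) ≤ ∫⁻_L g i` for compact `L` on which `δ c < φ`
  have level : ∀ (L : Set X), IsCompact L → ∀ t : ℝ≥0∞, (∀ x ∈ L, t < φ x) →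
      ∃ i, t * μ L ≤ ∫⁻ x in L, g i x ∂μ := by
    intro L hL t ht
    obtain ⟨i, hi⟩ := dini L hL t ht
    refine ⟨i, ?_⟩
    calc t * μ L = ∫⁻ _ in L, t ∂μ := (setLIntegral_const L t).symm
      _ ≤ ∫⁻ x in L, g i x ∂μ := setLIntegral_mono (hg i).measurable (fun x hx => (hi x hx).le)
  rw [lintegral_eq_nnreal]
  refine iSup₂_le fun s hs => ?_
  refine ENNReal.le_of_forall_lt_one_mul_le fun δ hδ => ?_
  rcases eq_or_ne δ 0 with rfl | hδ0
  · simp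
  rw [SimpleFunc.map_lintegral, Finset.mul_sum]
  -- points of a level set `s ⁻¹' {c}`, `c ≠ 0`, satisfy `δ c < φ`
  have hlev : ∀ c : ℝ≥0, c ≠ 0 → ∀ x ∈ s ⁻¹' ({c} : Set ℝ≥0), (δ * c : ℝ≥0∞) < φ x := by
    intro c hc x hx
    have hsx : s x = c := by simpa using hx
    calc (δ : ℝ≥0∞) * c < 1 * c :=
          ENNReal.mul_lt_mul_left (by exact_mod_cast hc) ENNReal.coe_ne_top hδ
      _ = (s x : ℝ≥0∞) := by rw [one_mul, hsx]
      _ ≤ φ x := hs x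
  by_cases hinf : ∃ c ∈ s.range, c ≠ 0 ∧ μ (s ⁻¹' {c}) = ∞
  · -- an infinite level set forces `⨆ i, ∫⁻ g i = ∞`
    obtain ⟨c, -, hc0, hμc⟩ := hinf
    suffices htop : ⨆ i, ∫⁻ x, g i x ∂μ = ∞ by rw [htop]; exact le_top
    rw [iSup_eq_top]
    intro b hb
    have hδc0 : (δ * c : ℝ≥0∞) ≠ 0 := mul_ne_zero hδ0 (by exact_mod_cast hc0)
    have hδctop : (δ * c : ℝ≥0∞) ≠ ∞ := ENNReal.mul_ne_top hδ.ne_top ENNReal.coe_ne_top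
    have hU : IsOpen {x | (δ * c : ℝ≥0∞) < φ x} := hφ.isOpen_preimage _
    have hμU : μ {x | (δ * c : ℝ≥0∞) < φ x} = ∞ :=
      eq_top_iff.mpr (hμc ▸ measure_mono (fun x hx => hlev c hc0 x hx))
    obtain ⟨L, hLU, hL, hbL⟩ := hU.exists_lt_isCompact (r := b / (δ * c))
      (by rw [hμU]; exact ENNReal.div_lt_top hb.ne hδc0)
    obtain ⟨i, hi⟩ := level L hL (δ * c) (fun x hx => hLU hx)
    refine ⟨i, ?_⟩
    calc b = b / (δ * c) * (δ * c) := (ENNReal.div_mul_cancel hδc0 hδctop).symm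
      _ < μ L * (δ * c) := ENNReal.mul_lt_mul_left hδc0 hδctop hbL
      _ = δ * c * μ L := mul_comm _ _
      _ ≤ ∫⁻ x in L, g i x ∂μ := hi
      _ ≤ ∫⁻ x, g i x ∂μ := setLIntegral_le_lintegral _ _
  · simp only [not_exists, not_and] at hinf
    -- every nonzero level set has finite measure: approximate it by compact sets from inside
    have key : ∀ c ∈ s.range, (δ : ℝ≥0∞) * ((c : ℝ≥0∞) * μ (s ⁻¹' {c})) ≤
        ⨆ i, ∫⁻ x in s ⁻¹' {c}, g i x ∂μ := by
      intro c hc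
      by_cases hc0 : c = 0
      · simp [hc0]
      have hA : MeasurableSet (s ⁻¹' ({c} : Set ℝ≥0)) := s.measurableSet_preimage _
      rw [← mul_assoc, MeasurableSet.measure_eq_iSup_isCompact_of_ne_top hA (hinf c hc hc0),
        ENNReal.mul_iSup]
      refine iSup_le fun L => ?_
      rw [ENNReal.mul_iSup]
      refine iSup_le fun hLA => ?_
      rw [ENNReal.mul_iSup]
      refine iSup_le fun hL => ?_
      obtain ⟨i, hi⟩ := level L hL (δ * c) (fun x hx => hlev c hc0 x (hLA hx))
      exact (hi.trans (lintegral_mono_set hLA)).trans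
        (le_iSup (fun i => ∫⁻ x in s ⁻¹' {c}, g i x ∂μ) i)
    have hdir' : ∀ i j, ∃ k, ∀ c : ℝ≥0, ∫⁻ x in s ⁻¹' {c}, g i x ∂μ ≤ ∫⁻ x in s ⁻¹' {c}, g k x ∂μ ∧
        ∫⁻ x in s ⁻¹' {c}, g j x ∂μ ≤ ∫⁻ x in s ⁻¹' {c}, g k x ∂μ := by
      intro i j
      obtain ⟨k, hik, hjk⟩ := hdir i j
      exact ⟨k, fun c => ⟨lintegral_mono fun x => hik x, lintegral_mono fun x => hjk x⟩⟩
    calc ∑ c ∈ s.range, (δ : ℝ≥0∞) * ((c : ℝ≥0∞) * μ (s ⁻¹' {c}))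
        ≤ ∑ c ∈ s.range, ⨆ i, ∫⁻ x in s ⁻¹' {c}, g i x ∂μ := Finset.sum_le_sum key
      _ = ⨆ i, ∑ c ∈ s.range, ∫⁻ x in s ⁻¹' {c}, g i x ∂μ := ENNReal.finsetSum_iSup hdir'
      _ = ⨆ i, ∫⁻ x in ⋃ c ∈ s.range, s ⁻¹' {c}, g i x ∂μ := by
          congr 1 with i
          rw [lintegral_biUnion_finset (fun c _ d _ hcd => ?_) (fun c _ => s.measurableSet_preimage _)]
          exact Set.disjoint_iff.mpr fun x ⟨hxc, hxd⟩ => hcd (by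
            simp only [mem_preimage, mem_singleton_iff] at hxc hxd; rw [← hxc, ← hxd])
      _ ≤ ⨆ i, ∫⁻ x, g i x ∂μ := iSup_mono fun i => setLIntegral_le_lintegral _ _

/-- **τ-smoothness of regular measures** (equality form): for an upward directed family of lower
semicontinuous functions `g i : X → [0, ∞]` and a regular measure `μ`,
`∫⁻ (⨆ i, g i) dμ = ⨆ i, ∫⁻ g i dμ`, even for uncountable index sets. [folklore] -/
theorem lintegral_iSup_of_directed_of_lowerSemicontinuous [OpensMeasurableSpace X]
    {μ : Measure X} [μ.Regular] {ι : Type*} [Nonempty ι] {g : ι → X → ℝ≥0∞}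
    (hg : ∀ i, LowerSemicontinuous (g i)) (hdir : Directed (· ≤ ·) g) :
    ∫⁻ x, ⨆ i, g i x ∂μ = ⨆ i, ∫⁻ x, g i x ∂μ :=
  le_antisymm
    (lintegral_le_iSup_lintegral_of_directed_of_lowerSemicontinuous hg hdir
      (lowerSemicontinuous_iSup hg) fun _ => le_rfl)
    (iSup_le fun i => lintegral_mono fun x => le_iSup (fun i => g i x) i)

end Literature.MeasureTheory.Radon
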